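import Summits.BirchSwinnertonDyer.BirchSwinnertonDyer.Theorems.Rank2Observatory2DescClFieldCert
import HarnessLib

/-!
# BirchSwinnertonDyer — rank ≥ 2 observatory: KERNEL-2DESC-CL v2.1 — the signature-free CORE of the per-field checker

HONEST FRAMING: per-curve certified theorems and census instruments; no claim on BSD in rank ≥ 2.

`ClFieldCert.check` (file 3 of KERNEL-2DESC-CL v2.0, `…2DescClFieldCert`) bundles an archimedean clause
(`Δ(g) < 0`, one isolating interval: a COMPLEX cubic field) with three clauses that do not depend on the
signature of `K = ℚ(α)`: irreducibility modulo `pIrr`, the Minkowski sweep with its class certificates, the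
registry rows, the residue characters.  This file names the latter conjunction `ClFieldCert.checkCore` and
re-derives from it alone every non-archimedean field-level consequence of file 3 (`irreducible_of_core`,
`row_check_of_mem_core`, `qEntry_check_core`, `w₁_of_core`, `w₂_of_core`, `qcover_of_core`, `w₁_ne_w₂_core`,
`closure_q_eq_top_of_core` — the classes of the primes above `q` generate `Cl(K)` —, `exists_psi_of_core`),
so that the same registry / sweep / character data serve a TOTALLY REAL cubic 2-division field (v2.1 of the
lane: `…2DescClRealCert`, three real places) as well as the complex one (`checkCore_of_check`).  The proofs are
those of file 3 with the hypothesis weakened.  Sorry-free; axioms `propext`, `Classical.choice`, `Quot.sound`.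
[cite: Cohen1993, §4.8.2, §6.5] [cite: Marcus2018, Ch. 5, Thm. 35 and Cor. 2] [cite: Cassels1991LecturesEllipticCurves, §15]
-/

set_option linter.dupNamespace false

noncomputable section

open scoped Classical NumberField nonZeroDivisors

open Literature.NumberTheory.NumberFields Polynomial Module NumberField IsDedekindDomain Ideal

namespace Summit.BirchSwinnertonDyer.BirchSwinnertonDyer.Rank2Observatory.TwoDescCl

open TwoDescCubic

namespace ClFieldCert

/-- **The signature-free core of the per-field checker**: irreducibility modulo `pIrr`, the Minkowski sweep,
the registry rows, the residue characters — `check` minus its archimedean clause, in the same bracket shape.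
Computable. [cite: Cohen1993, §6.5] -/
def checkCore (fc : ClFieldCert) : Bool :=
  noRootMod fc.pIrr fc.a fc.b fc.c && fc.checkSweep && fc.checkRegistry && fc.checkChars

/-- The full (complex-field) checker implies the core. -/
theorem checkCore_of_check (fc : ClFieldCert) (hF : fc.check = true) : fc.checkCore = true := by
  simp only [check, checkField, checkCore, Bool.and_eq_true] at hF ⊢
  exact ⟨⟨⟨hF.1.1.1.1.1, hF.1.1.2⟩, hF.1.2⟩, hF.2⟩

end ClFieldCert

/-! ## Soundness: the non-archimedean field-level consequences of the core -/

variable {K : Type*} [Field K] [NumberField K] {θ : K} (fc : ClFieldCert)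

namespace ClFieldCert

/-- `g` is irreducible. [folklore] -/
theorem irreducible_of_core (hC : fc.checkCore = true) : Irreducible (MonicCubic.polyQ fc.a fc.b fc.c) := by
  simp only [checkCore, Bool.and_eq_true] at hC
  exact irreducible_of_noRootMod hC.1.1.1

/-- Every registry row is checked, and its prime is not `q`. -/
theorem row_check_of_mem_core (hC : fc.checkCore = true) {e : PrimeEntry} (he : e ∈ fc.primes) :
    e.check fc.a fc.b fc.c = true ∧ e.p ≠ fc.q := by
  simp only [checkCore, checkRegistry, Bool.and_eq_true, List.all_eq_true] at hC
  have h := hC.1.2.2 e he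
  exact ⟨h.1, by simpa using h.2⟩

/-- The row of `q` is checked. -/
theorem qEntry_check_core (hC : fc.checkCore = true) : fc.qEntry.check fc.a fc.b fc.c = true := by
  simp only [checkCore, checkRegistry, Bool.and_eq_true] at hC
  exact hC.1.2.1

/-- `W₁` is a prime above `q` of norm `q`. [cite: Cohen1993, §4.8.2] -/
theorem w₁_of_core (hθ : aeval θ (MonicCubic.poly fc.a fc.b fc.c) = 0) (h3 : finrank ℚ K = 3)
    (hC : fc.checkCore = true) (hpr : fc.primeList.Forall Nat.Prime) :
    idealOf hθ fc.w₁ ∈ primesOver (span {(fc.q : ℤ)}) (𝓞 K) ∧ absNorm (idealOf hθ fc.w₁) = fc.q := by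
  have h := (primeEntry_sound (fc.irreducible_of_core hC) hθ h3 fc.qEntry (fc.q_prime hpr)
    (fc.qEntry_check_core hC)).1 fc.w₁ (by rw [qEntry_codes]; simp)
  have hdeg : codeDeg fc.w₁ = 1 := by simp [codeDeg, w₁]
  rw [hdeg, pow_one] at h
  exact h

/-- `W₂` is a prime above `q` of norm `q²`. [cite: Cohen1993, §4.8.2] -/
theorem w₂_of_core (hθ : aeval θ (MonicCubic.poly fc.a fc.b fc.c) = 0) (h3 : finrank ℚ K = 3)
    (hC : fc.checkCore = true) (hpr : fc.primeList.Forall Nat.Prime) :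
    idealOf hθ fc.w₂ ∈ primesOver (span {(fc.q : ℤ)}) (𝓞 K) ∧ absNorm (idealOf hθ fc.w₂) = fc.q ^ 2 := by
  have h := (primeEntry_sound (fc.irreducible_of_core hC) hθ h3 fc.qEntry (fc.q_prime hpr)
    (fc.qEntry_check_core hC)).1 fc.w₂ (by rw [qEntry_codes]; simp)
  have hdeg : codeDeg fc.w₂ = 2 := by simp [codeDeg, w₂]
  rw [hdeg] at h
  exact h

/-- Every prime containing `q` is `W₁` or `W₂`. [cite: Cohen1993, §4.8.2, Thm. 4.8.13] -/
theorem qcover_of_core (hθ : aeval θ (MonicCubic.poly fc.a fc.b fc.c) = 0) (h3 : finrank ℚ K = 3)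
    (hC : fc.checkCore = true) (hpr : fc.primeList.Forall Nat.Prime) (P : Ideal (𝓞 K)) (hP : P.IsPrime)
    (hq : (fc.q : 𝓞 K) ∈ P) : P = idealOf hθ fc.w₁ ∨ P = idealOf hθ fc.w₂ := by
  obtain ⟨C, hC, rfl⟩ := (primeEntry_sound (fc.irreducible_of_core hC) hθ h3 fc.qEntry (fc.q_prime hpr)
    (fc.qEntry_check_core hC)).2 P hP hq
  rw [qEntry_codes] at hC
  simp only [List.mem_cons, List.not_mem_nil, or_false] at hC
  rcases hC with rfl | rfl
  · exact Or.inl rfl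
  · exact Or.inr rfl

/-- `W₁ ≠ W₂` (different norms). [folklore] -/
theorem w₁_ne_w₂_core (hθ : aeval θ (MonicCubic.poly fc.a fc.b fc.c) = 0) (h3 : finrank ℚ K = 3)
    (hC : fc.checkCore = true) (hpr : fc.primeList.Forall Nat.Prime) :
    idealOf hθ fc.w₁ ≠ idealOf hθ fc.w₂ := by
  intro h
  have h₁ := (fc.w₁_of_core hθ h3 hC hpr).2
  have h₂ := (fc.w₂_of_core hθ h3 hC hpr).2
  rw [h, h₂] at h₁
  have hq := (fc.q_prime hpr).one_lt
  have : fc.q ^ 2 = fc.q ^ 1 := by rw [pow_one]; exact h₁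
  exact absurd (Nat.pow_right_injective hq this) (by norm_num)

/-- **The classes of the primes above `q` generate the class group.**
[cite: Marcus2018, Ch. 5, Cor. 2 to Thm. 35] [cite: Cohen1993, §6.5] -/
theorem closure_q_eq_top_of_core (hθ : aeval θ (MonicCubic.poly fc.a fc.b fc.c) = 0)
    (h3 : finrank ℚ K = 3) (hC : fc.checkCore = true) (hpr : fc.primeList.Forall Nat.Prime) :
    Subgroup.closure {cc : ClassGroup (𝓞 K) | ∃ (J : Ideal (𝓞 K)) (hJ : J ∈ (Ideal (𝓞 K))⁰),
      ((fc.q : ℕ) : 𝓞 K) ∈ J ∧ ClassGroup.mk0 ⟨J, hJ⟩ = cc} = ⊤ := by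
  have hirr := fc.irreducible_of_core hC
  have hC' := hC
  simp only [checkCore, checkSweep, Bool.and_eq_true, decide_eq_true_eq, List.all_eq_true, List.mem_range,
    Bool.or_eq_true, beq_iff_eq, List.any_eq_true] at hC'
  obtain ⟨⟨⟨-, ⟨⟨hd, hcov⟩, hcls⟩⟩, -⟩, -⟩ := hC'
  refine eq_top_of_classIn_lt hirr hθ h3 (b := fc.bM) hd fun p hpb hp P hP hlt => ?_
  have hpP : (p : 𝓞 K) ∈ P := sweep_natCast_mem p hP
  have hPr : P.IsPrime := hP.1
  rcases hcov p hpb with ((hlt2 | hsf) | rfl) | ⟨e, he, hep⟩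
  · exact absurd hp.two_le (by omega)
  · rw [smallFactor_eq_false hp] at hsf; exact absurd hsf Bool.false_ne_true
  · rcases fc.qcover_of_core hθ h3 hC hpr P hPr hpP with h | h <;> rw [h]
    · exact classIn_tsupp_span_pair_self _ _
    · exact classIn_tsupp_span_pair_self _ _
  · subst hep
    have hrow := (fc.row_check_of_mem_core hC he).1
    have hp' := fc.prime_of_mem hpr he
    obtain ⟨C, hC, rfl⟩ := cover_of_check hirr hθ h3 hp' hrow P hPr hpP
    rcases hcls e he with hb | hall
    · exfalso
      refine not_pow_inertiaDeg_lt (mem_primesOver_of_check hirr hθ h3 hp' hrow hC)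
        (absNorm_of_check hirr hθ h3 hp' hrow hC) ?_ hlt
      exact hb.trans (Nat.le_self_pow (codeDeg_pos C).ne' _)
    · obtain ⟨d, -, hcc⟩ := hall C hC
      exact classIn_of_classCheck hirr hθ h3 hp' hrow hC (fc.q_prime hpr) hcc hlt

/-- **The residue map `ψ_{ℓ,t} : 𝓞 K → ℤ/ℓ`, `α ↦ t`**, for every character row, with `ℓ` an odd prime.
[cite: Marcus2018, Ch. 3, Thm. 27] -/
theorem exists_psi_of_core (hθ : aeval θ (MonicCubic.poly fc.a fc.b fc.c) = 0) (h3 : finrank ℚ K = 3)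
    (hC : fc.checkCore = true) (hpr : fc.primeList.Forall Nat.Prime) {ch : ℕ × ℤ × ℤ} (hch : ch ∈ fc.chars) :
    2 < ch.1 ∧ ∃ ψ : 𝓞 K →+* ZMod ch.1, ψ (MonicCubic.thetaInt hθ) = ((ch.2.1 : ℤ) : ZMod ch.1) := by
  have hirr := fc.irreducible_of_core hC
  simp only [checkCore, checkChars, Bool.and_eq_true, decide_eq_true_eq, List.all_eq_true] at hC
  obtain ⟨⟨h2, hroot⟩, hinv⟩ := hC.2 ch hch
  obtain ⟨ℓ, t, dinv⟩ := ch
  simp only at h2 hroot hinv ⊢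
  have hℓ : ℓ.Prime := fc.char_prime hpr hch
  haveI : NeZero ℓ := ⟨hℓ.ne_zero⟩
  refine ⟨h2, MonicCubic.exists_ringHom_of_root_of_mul_mem hirr hθ h3 (natAbs_disc_mul_mem_adjoin hirr hθ h3)
    ((t : ℤ) : ZMod ℓ) ?_ ((dinv : ℤ) : ZMod ℓ) ?_⟩
  · have h0 := (ZMod.intCast_zmod_eq_zero_iff_dvd _ ℓ).mpr (Int.dvd_of_emod_eq_zero hroot)
    push_cast at h0
    exact h0
  · have h1 : ((((MonicCubic.disc fc.a fc.b fc.c).natAbs : ℤ) * dinv : ℤ) : ZMod ℓ) = ((1 : ℤ) : ZMod ℓ) := by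
      rw [ZMod.intCast_eq_intCast_iff', hinv, Int.emod_eq_of_lt (by norm_num) (by have := hℓ.one_lt; omega)]
    simp only [Int.cast_mul, Int.cast_natCast, Int.cast_one] at h1
    exact h1

end ClFieldCert

end Summit.BirchSwinnertonDyer.BirchSwinnertonDyer.Rank2Observatory.TwoDescCl
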